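import Literature.Computability.Complexity.Circuit
import Literature.Computability.Complexity.CircuitComposition
import Mathlib.Data.Finset.Card
import Mathlib.Data.Fintype.Prod
import Mathlib.Data.Fintype.Pi
import Mathlib.Data.Real.Basic
import Mathlib.Tactic.Positivity
import Mathlib.Tactic.Linarith
import HarnessLib

/-!
# Barrier catalogue `PneNP`: the limits of gate elimination (Golovnev–Hirsch–Knop–Kulikov 2016)

D-0021 barrier entry for the summit `PneNP`, bearing on route PneNP/Circuit's crux #2
(`Summits/PneNP/PneNP/Theses/Circuit.lean`: a superlinear lower bound
`∃ L ∈ NP, ∀ c, ∃ᶠ n, c·n < circuitSize L n`, frontier `3.1n - o(n)`): "Practically, the only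
known method for proving lower bounds [for general Boolean circuits] is the gate elimination
method" — and a gate-elimination induction that gains a constant per substitution cannot tell
functions of huge complexity from easy ones, because there are functions of (virtually)
arbitrary complexity that lose only `O(1)` gates under ANY substitution of `m` variables by
arbitrary functions of the others.

**The printed results** (A. Golovnev, E. A. Hirsch, A. Knop, A. S. Kulikov, *On the limits of
gate elimination*, MFCS 2016 (LIPIcs 58, 46) = J. Comput. Syst. Sci. 96 (2018); held, `lit read
paper:doi-10-4230-lipics-mfcs-2016-46`, 13 PDF pages):

* §1 (PDF pp. 1–2): circuits = DAGs with inputs `x₁, …, xₙ` and fan-in-2 gates labelled by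
  binary Boolean functions, `gates(C)` the number of gates, `gates(f)` its minimum; "we prove
  that this method cannot achieve linear bounds of `cn` beyond a certain constant `c`, where `c`
  depends only on the number of substitutions made at a single step of the induction"; "The
  currently strongest known lower bound is `(3 + 1/86)n - o(n)`" ; "Practically, the only known
  method for proving lower bounds is the gate elimination method."
* §3.1 (PDF p. 5): "A substitution `ρ` of a set of variables `R ⊆ X` is a set of `|R|`
  restrictions of the form `rᵢ = fᵢ(x₁, …, xₙ)`, one restriction for each variable `rᵢ ∈ R`,
  where `fᵢ` depends only on variables from `X ∖ R`. ... The size of a substitution is `|R|`.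
  Substitutions of size `m` are called `m`-substitutions. Given an `m`-substitution `ρ` and a
  function `f`, one can naturally define a new function `f|_ρ` that has `m` fewer arguments than
  `f`"; a *gate elimination argument* consists of a complexity measure `μ`, families of
  substitutions and functions, a `gain : ℕ → ℝ` and proofs of measure usefulness, invariance and
  the induction step "`μ(f|_ρ) ≤ μ(f) - gain(n)`" ("In known proofs, `gain(n)` is constant").
* §3.2 (PDF pp. 5–6): `f ⋄ MAJ₃`, "no substitution `x_{ij} ← ρ`, where `ρ` is any function of
  all the remaining variables, can remove from `C` more than 5 gates"; "Taking into account the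
  fact that the majority of `2m + 1` bits can be computed by a circuit of size `4.5(2m + 1)` [8],
  we get the following result. **Lemma 1.** For any `m > 0`, for any function `h` of `n` inputs,
  there exists a function `f = h ⋄ MAJ_{2m+1}` of `n(2m+1)` variables, such that — Circuit
  complexity of `f` is close to that of `h`: `gates(h) ≤ gates(f) ≤ gates(h) + 4.5(2m+1)n`, —
  For any `m`-substitution `ρ`, `gates(f) - gates(f|_ρ) ≤ 4.5(2m+1)m`" (PDF p. 6); Remark:
  `h` may be taken of "virtually any circuit complexity from `n` to `2ⁿ/n`".
* §3.3 (PDF p. 7): block composition `h = f ⋄ g`, weakly `m`-stable gadgets (Def. 2), Thm. 3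
  (subadditive measures: `μ(h) - μ(h|_ρ) ≤ m·μ(g)`); §3.4 (PDF pp. 7–9): `m`-stable gadgets,
  Thm. 5 and Cor. 7 for the measures `μ_α = gates + α·inputs`: "Thus, for many functions gate
  elimination with `m`-substitutions and `μ_α` measures can prove only `O(n)` lower bounds";
  §4 (PDF p. 10): "each symmetric function ... can be computed by a circuit of size
  `4.5n + o(n)`" (their [6]); (PDF p. 11): "This puts a barrier on gate elimination proofs that
  do not use specific properties of the functions while analyzing how their circuits degrade
  after substitutions."

**What this file adds.** The technique class as explicit definitions over the tree's
straight-line `B₂`-circuits (`Literature.CplxCore.circuitSizeOver B2`, any finite set of input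
variables): block composition `blockCompose h g = h ⋄ g` (variables `Fin n × Fin k`), the
majority gadget `majFn t` (the truth table of the tree's gate `GateFn.maj t`), substitutions of
a set `R` of variables by functions of the remaining ones (`Substitution`, §3.1) and the
restricted function `Substitution.apply f` on the variables outside `R`. Of Lemma 1's three
inequalities the first, `gates(h) ≤ gates(h ⋄ MAJ_{2m+1})`, is PROVED here in the tree model
(`circuitSizeOver_le_blockCompose`: feed every block `2m+1` copies of `xᵢ`, a free rewiring —
`CktSize.rewire` — and use `MAJ(b, …, b) = b`); the other two (which rest on the
`4.5(2m+1)`-gate majority circuits of GHKK's ref. [8] and on the gadget-repair construction)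
are vendored AS PRINTED as the named fact `GateEliminationLimit`, and `GateEliminationLimit.lemma1`
reassembles the printed three-part statement. PROVED readings: the one-step gain of ANY
measure-`gates` gate-elimination step on `h ⋄ MAJ_{2m+1}` by an `m`-substitution is
`≤ 4.5(2m+1)m` however complex `h` is (`GateEliminationLimit.gain_le`), so an induction step
demanding a larger constant gain has no instance at these functions
(`GateEliminationLimit.no_step_with_large_gain`), while their complexity is within `4.5(2m+1)n`
of that of an arbitrary `h` (`.complexity_sandwich`).

## Sources

* [GolovnevHirschKnopKulikov2016] PDF pp. 1–2 (abstract, §1), p. 5 (§3.1), pp. 5–6 (§3.2,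
  Lemma 1, Remark), p. 7 (§3.3, Def. 2, Thm. 3), pp. 7–9 (§3.4, Def. 4, Thm. 5, Lemma 6,
  Cor. 7), p. 10–11 (§4) — held.
* [Vollmer1999] Def. 1.7, §1.2 — through `Circuit.lean` (`circuitSizeOver`) and
  `CircuitComposition.lean` (`CktSize.rewire`, `cktSize_univ`, `CktSize.toCircuit`).
-/

noncomputable section

namespace Literature.Barriers.PneNP

open Finset Literature.Computability.Complexity

/-! ### Block composition and the majority gadget -/

/-- **Block composition `h ⋄ g`**: "by `h = f ⋄ g` we denote the function of `nk` variables
resulting from `f` by replacing each of its input variables by `h` [sic — read `g`; cf. the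
instance `f ⋄ MAJ₃` of §3.2: "replacing each of its input variables `xᵢ` by the majority
function of three fresh variables"] applied to `k` fresh variables" — variables indexed by
`Fin n × Fin k` (block `i`, position `j`); here the outer function is called `h` and the gadget
`g`. [cite: GolovnevHirschKnopKulikov2016, §3.3 (PDF p. 7) and §3.2 (PDF p. 5)] -/
def blockCompose {n k : ℕ} (h : (Fin n → Bool) → Bool) (g : (Fin k → Bool) → Bool) :
    (Fin n × Fin k → Bool) → Bool :=
  fun x => h fun i => g fun j => x (i, j)

/-- The majority function of `t` bits, as the truth table of the tree's majority gate
`GateFn.maj t` ("at least half of the inputs are `1`", `t ≤ 2·#ones`); for odd `t = 2m+1` this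
is `MAJ_{2m+1}` (more than `m` ones). [cite: GolovnevHirschKnopKulikov2016, §3.2 (PDF pp. 5–6)] -/
def majFn (t : ℕ) : (Fin t → Bool) → Bool := (GateFn.maj t).2

/-- Unfolding `majFn`. [folklore] -/
theorem majFn_apply (t : ℕ) (x : Fin t → Bool) :
    majFn t x = decide (t ≤ 2 * GateFn.numOnes x) := rfl

/-- Feeding every block the same bit recovers `h`: `(h ⋄ g)(x ∘ Prod.fst) = h(g(x_i, …, x_i))`,
in particular `= h x` when `g` of a constant vector returns that constant (as `MAJ` does) —
the rewiring behind `gates(h) ≤ gates(h ⋄ MAJ)`. [cite: GolovnevHirschKnopKulikov2016, Lemma 1 (PDF p. 6)] -/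
theorem blockCompose_comp_fst {n k : ℕ} (h : (Fin n → Bool) → Bool) (g : (Fin k → Bool) → Bool)
    (hg : ∀ b : Bool, g (fun _ => b) = b) (x : Fin n → Bool) :
    blockCompose h g (fun p => x p.1) = h x := by
  simp [blockCompose, hg]

/-- The all-ones vector of length `t` has `t` ones. [folklore] -/
theorem numOnes_const_true (t : ℕ) : GateFn.numOnes (fun _ : Fin t => true) = t := by
  unfold GateFn.numOnes
  rw [Finset.filter_true_of_mem fun _ _ => rfl, card_univ, Fintype.card_fin]

/-- The all-zeros vector has no ones. [folklore] -/
theorem numOnes_const_false (t : ℕ) : GateFn.numOnes (fun _ : Fin t => false) = 0 := by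
  simp [GateFn.numOnes]

/-- Majority of a constant vector of odd length `2m+1` is that constant. [folklore] -/
theorem majFn_const (m : ℕ) (b : Bool) : majFn (2 * m + 1) (fun _ => b) = b := by
  cases b
  · rw [majFn_apply, numOnes_const_false]
    simp
  · rw [majFn_apply, numOnes_const_true, decide_eq_true_eq]
    omega

/-! ### The first inequality of Lemma 1, proved in the tree model -/

/-- A circuit over `B` computing `f` is a single-output straight-line realization of `f` of the
same size (the converse of `CktSize.toCircuit`). [folklore] -/
theorem cktSize_of_circuit {ι : Type} {B : Set GateFn} (C : Circuit ι) (hB : C.IsOver B)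
    {f : (ι → Bool) → Bool} (hC : C.Computes f) :
    CktSize B (fun x (_ : Unit) => f x) C.size := by
  refine ⟨C.gates, fun _ => C.output, le_rfl,
    ⟨GateList.wf_gates C, hB, fun _ m hm => C.wf_output m hm, fun x _ => ?_⟩⟩
  rw [← hC x]
  obtain ⟨gates, output, wf, wfo⟩ := C
  cases output with
  | inl i => rfl
  | inr m => rfl

/-- **Lemma 1, first inequality (proved): `gates(h) ≤ gates(h ⋄ g)`** over `B₂` for every gadget
`g` returning `b` on the constant vector `b` (e.g. `MAJ_{2m+1}`, `majFn_const`): take an optimal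
`B₂`-circuit for `h ⋄ g` (one exists, `cktSize_univ`) and wire all `k` variables of block `i` to
the input `xᵢ` — renaming inputs is free (`CktSize.rewire`) and the rewired circuit computes `h`
(`blockCompose_comp_fst`). [cite: GolovnevHirschKnopKulikov2016, Lemma 1 (PDF p. 6)] -/
theorem circuitSizeOver_le_blockCompose {n k : ℕ} (h : (Fin n → Bool) → Bool)
    (g : (Fin k → Bool) → Bool) (hg : ∀ b : Bool, g (fun _ => b) = b) :
    circuitSizeOver B2 h ≤ circuitSizeOver B2 (blockCompose h g) := by
  -- an optimal circuit for `h ⋄ g` exists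
  have hne : {s | ∃ C : Circuit (Fin n × Fin k), C.IsOver B2 ∧ C.Computes (blockCompose h g) ∧
      C.size = s}.Nonempty := by
    obtain ⟨C, hB, -, hC⟩ :=
      (cktSize_univ fun (x : Fin n × Fin k → Bool) (_ : Unit) => blockCompose h g x).toCircuit
    exact ⟨C.size, C, hB, fun x => hC x, rfl⟩
  obtain ⟨C, hB, hC, hs⟩ := Nat.sInf_mem hne
  -- rewire block variables `(i, j)` to `i`
  have h1 := (cktSize_of_circuit C hB hC).rewire (ι' := Fin n) Prod.fst
  have h2 : CktSize B2 (fun (x : Fin n → Bool) (_ : Unit) => h x) C.size :=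
    h1.congr fun x _ => blockCompose_comp_fst h g hg x
  obtain ⟨C', hB', hs', hC'⟩ := h2.toCircuit
  calc circuitSizeOver B2 h ≤ C'.size := circuitSizeOver_le_of_computes C' hB' fun x => hC' x
    _ ≤ C.size := hs'
    _ = circuitSizeOver B2 (blockCompose h g) := hs

/-! ### Substitutions (§3.1) -/

/-- **A substitution** of a set `R` of variables by functions of the remaining variables: "a
set of `|R|` restrictions of the form `rᵢ = fᵢ(x₁, …, xₙ)`, one restriction for each variable
`rᵢ ∈ R`, where `fᵢ` depends only on variables from `X ∖ R`" — here `fn r` is a function of an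
assignment to the complement of `R` (values of `fn` off `R` are irrelevant). Its SIZE is `|R|`;
substitutions of size `m` are `m`-substitutions; the degree of the `fᵢ` is unrestricted
(arbitrary functions, the most general case). [cite: GolovnevHirschKnopKulikov2016, §3.1 (PDF p. 5)] -/
structure Substitution (ι : Type) [Fintype ι] [DecidableEq ι] where
  /-- the substituted variables -/
  R : Finset ι
  /-- the substituting functions, reading only the remaining variables -/
  fn : ι → ((↥(Rᶜ) : Type) → Bool) → Bool

variable {ι : Type} [Fintype ι] [DecidableEq ι]

/-- The size `|R|` of a substitution. [cite: GolovnevHirschKnopKulikov2016, §3.1 (PDF p. 5)] -/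
def Substitution.size (ρ : Substitution ι) : ℕ := ρ.R.card

/-- Extending an assignment of the remaining variables by the substitution. [cite: GolovnevHirschKnopKulikov2016, §3.1 (PDF p. 5)] -/
def Substitution.extend (ρ : Substitution ι) (z : (↥(ρ.Rᶜ) : Type) → Bool) : ι → Bool :=
  fun i => if h : i ∈ ρ.R then ρ.fn i z else z ⟨i, by simpa using h⟩

/-- **The restricted function `f|_ρ`**: the function of the remaining variables `X ∖ R`
obtained by plugging the substitution into `f` ("a new function `f|_ρ` that has `m` fewer
arguments than `f`"). [cite: GolovnevHirschKnopKulikov2016, §3.1 (PDF p. 5)] -/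
def Substitution.apply (ρ : Substitution ι) (f : (ι → Bool) → Bool) :
    ((↥(ρ.Rᶜ) : Type) → Bool) → Bool :=
  fun z => f (ρ.extend z)

/-- Off `R` the extended assignment is the given one. [folklore] -/
theorem Substitution.extend_of_not_mem (ρ : Substitution ι) (z : (↥(ρ.Rᶜ) : Type) → Bool)
    {i : ι} (hi : i ∉ ρ.R) : ρ.extend z i = z ⟨i, by simpa using hi⟩ := by
  simp [Substitution.extend, hi]

/-- On `R` the extended assignment is the substituted value. [folklore] -/
theorem Substitution.extend_of_mem (ρ : Substitution ι) (z : (↥(ρ.Rᶜ) : Type) → Bool)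
    {i : ι} (hi : i ∈ ρ.R) : ρ.extend z i = ρ.fn i z := by
  simp [Substitution.extend, hi]

/-- The empty substitution (size `0`) restricts nothing: `f|_∅ (z) = f (z ∘ incl)`.
[folklore] -/
def Substitution.empty (ι : Type) [Fintype ι] [DecidableEq ι] : Substitution ι :=
  ⟨∅, fun _ _ => false⟩

/-- The empty substitution has size `0`. [folklore] -/
theorem Substitution.size_empty : (Substitution.empty ι).size = 0 := rfl

/-! ### The barrier fact: Lemma 1 -/

/-- **Golovnev–Hirsch–Knop–Kulikov 2016, Lemma 1** (second and third inequalities; the first is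
the theorem `circuitSizeOver_le_blockCompose`). "For any `m > 0`, for any function `h` of `n`
inputs, there exists a function `f = h ⋄ MAJ_{2m+1}` of `n(2m+1)` variables, such that —
`gates(h) ≤ gates(f) ≤ gates(h) + 4.5(2m+1)n`, — For any `m`-substitution `ρ`,
`gates(f) - gates(f|_ρ) ≤ 4.5(2m+1)m`." Over the tree: `gates = circuitSizeOver B2`
(straight-line circuits with gates of fan-in `≤ 2`, containing GHKK's fan-in-2 circuits),
`f = blockCompose h (majFn (2m+1))`, `m`-substitutions = `Substitution` of size exactly `m` by
arbitrary functions of the remaining variables, `f|_ρ = ρ.apply f`. Both inequalities are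
stated with the printed constants (the repair construction of the proof — fresh `MAJ_{2m+1}`
gadgets of `4.5(2m+1)` gates wired into `m+1` untouched variables of each of the `≤ m` touched
blocks — transfers verbatim to straight-line circuits, whose output wire may point at a gate).
Named fact.

BARRIER
technique_class: gate-elimination, substitution-induction, m-substitutions, measure-gates-plus-inputs, linear-circuit-lower-bounds, b2-circuits
blocks: gate-elimination arguments — inductions that at each step find a substitution of exactly `m` variables (an `m`-substitution, §3.1) decreasing the measure `gates` (or `gates + α·inputs`) by `gain(n)` — as a road to route PneNP/Circuit's crux #2 (a SUPERLINEAR `B₂`-circuit lower bound for an `NP` function; frontier `(3 + 1/86)n - o(n)`): on the functions `h ⋄ MAJ_{2m+1}`, of circuit complexity within `4.5(2m+1)n` of that of an ARBITRARY `h` (up to `2ⁿ/n`), every `m`-substitution gains at most `4.5(2m+1)m` gates (`GateEliminationLimit.gain_le`), so an induction step with constant gain `> 4.5(2m+1)m` is unavailable at these functions (`.no_step_with_large_gain`) — "this method cannot achieve linear bounds of `cn` beyond a certain constant `c`, where `c` depends only on the number of substitutions made at a single step" [cite: GolovnevHirschKnopKulikov2016, abstract (PDF p. 1), §3.1 (PDF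 p. 5), Lemma 1 (PDF p. 6)]; for subadditive measures and `gates + α·inputs` likewise with (weakly) `m`-stable gadgets (Thm. 3, Thm. 5, Cor. 7: "can prove only `O(n)` lower bounds") [cite: GolovnevHirschKnopKulikov2016, Thm. 3 (PDF p. 7) and Cor. 7 (PDF p. 9)].
because: from a circuit for `(h ⋄ MAJ_{2m+1})|_ρ` one rebuilds a circuit for `h ⋄ MAJ_{2m+1}`: an `m`-substitution touches at most `m` of the `n` majority gadgets, and in a touched block at most `m` of the `2m+1` variables are substituted, so feeding the value of a fresh copy of the gadget (size `4.5(2m+1)`) to `m+1` untouched variables of the block forces the block's majority to the right value regardless of the substituted ones (weak `m`-stability of `MAJ_{2m+1}`) — at most `m` gadgets, `4.5(2m+1)m` gates [cite: GolovnevHirschKnopKulikov2016, §3.2 (PDF p. 6) and proof of Thm. 3 (PDF p. 7)]; conversely feeding each gadget `2m+1` copies of `xᵢ` recovers `h` (`circuitSizeOver_le_blockCompose`), and attaching `n` gadgets to a circuit for `h` computes `f` [cite: GolovnevHirschKnopKulikov2016, Lemma 1 (PDF p. 6)].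
evasions_known: arguments that "use specific properties of the functions while analyzing how their circuits degrade after substitutions" are not covered ("This puts a barrier on gate elimination proofs that do not use specific properties of the functions") [cite: GolovnevHirschKnopKulikov2016, §4 (PDF p. 11)]; measures beyond subadditive ones / beyond `gates + α·inputs`, non-constant `gain(n)`, or substitution families for which the composed functions leave the invariant family `F` (the `stop` predicate of §3.1) are outside the formal template [cite: GolovnevHirschKnopKulikov2016, §3.1 (PDF p. 5)]; known `> 3n` bounds already combine gate elimination with affine dispersers, quadratic substitutions and amortised measures (§2) — all still within `O(1)` gain per step [cite: GolovnevHirschKnopKulikov2016, §1–§2 (PDF pp. 2–5)]. AUDIT 2026-08-16 (D-0021, `GateEliminationLimitScope.lean`): the no-go is formally silent on every invariant family that contains NO block composition `h ⋄ g` with a constant-arity forcible gadget — foremost the affine / polynomial-variety DISPERSERS FOR SUBLINEAR DIMENSION of every record proof (Demenkov–Kulikov 2011, Find–Golovnev–Hirsch–Kulikov 2016, Li–Yang 2022): each `h ⋄ MAJ_{2m+1}` on `N` variables is constant on a subcube of dimension `≥ N/3` (`blockCompose_majFn_not_isAffineDisperser`), so those families contain none of the resistant functions; that "the class of affine dispersers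 ... contains a series of functions resistant to gate elimination" is the authors' OPEN question 1 [cite: GolovnevHirschKnopKulikov2016, §5 (PDF p. 11)], cf. "(i) this requires the class to contain their constructions, which is not always given" and "provable barriers to using gate elimination to prove superlinear circuit bounds remain unknown" [cite: CarmosinoDangJackman2026, §1.2 and §1.1]; substitution blocks of growing size `m = m(n) → ∞` are not capped below a superlinear bound (`4.5(2m+1)` per eliminated variable is unbounded in `m`; resistance to `ω(√N)` substitutions is open) [cite: GolovnevHirschKnopKulikov2016, §5 (ECCC TR16-119 version, p. 12)]; see the narrowed entry `GateEliminationLimitNarrow`.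
scope_caveats: the vendored fact is Lemma 1 only (measure `gates`, gadget `MAJ_{2m+1}`, arbitrary-function substitutions of size EXACTLY `m`; substitutions of fewer than `m` variables are not covered by the printed statement); the constant `4.5(2m+1)` is printed bare, resting on the paper's citation "[8]" for majority circuits of size `4.5(2m+1)`, while the symmetric-function bound it quotes elsewhere carries an `o(n)` term ("`4.5n + o(n)`", §4, PDF p. 10) — instantiated at `n = 1`, `h` a projection, the fact asserts `gates(MAJ_{2m+1}) ≤ 4.5(2m+1)` for every `m ≥ 1`; this is nevertheless ESTABLISHED in the tree: `GateEliminationLimit_holds` (`GateEliminationLimitProofs.lean`, the fact being equivalent to `gates_{B₂}(MAJ_{2m+1}) ≤ 9m + 4`, `GateEliminationLimit_iff_majority_bound`, discharged by the verified MDFA counter `circuitSizeOver_maj_le : gates_{B₂}(MAJ_{2m+1}) ≤ 9m + 3` of `MajorityCircuit.lean`), and substitutions of AT MOST `m` variables are covered there (`circuitSizeOver_blockCompose_le_apply`) [cite: GolovnevHirschKnopKulikov2016, Lemma 1 (PDF p. 6) and §4 (PDF p. 10)]; REACH (audit 2026-08-16): the proved no-go readings quantify over step lemmas AT the functions `h ⋄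 MAJ_{2m+1}` only — a gate-elimination argument is blocked only if its invariant family contains one of them and its substitution size `m` is constant (`GateEliminationLimitNarrow`, `GateEliminationLimitScope.lean`); Thm. 3 / Thm. 5 / Cor. 7 (subadditive measures, `μ_α`, `m`-stable gadgets of constant but unspecified size) are quoted, not formalised; the functions `h ⋄ MAJ` are not claimed to be in `NP` for hard `h` — the barrier is about the METHOD's resolution ("we show a limitation of the proof method rather than a proof of a lower bound, we do not necessarily need to present explicit functions") [cite: GolovnevHirschKnopKulikov2016, §3.3 (PDF p. 7)]; GHKK's model is fan-in-exactly-2 circuits over all 16 binary functions, the tree's `B2` allows fan-in `≤ 2` (a superset of circuits; both printed constructions transfer as stated above).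
status: established — proved in the tree (`GateEliminationLimit_holds`, `GateEliminationLimitProofs.lean`); scope narrowed by audit 2026-08-16 (`GateEliminationLimitNarrow`) [cite: GolovnevHirschKnopKulikov2016, Lemma 1] -/
def GateEliminationLimit : Prop :=
  ∀ (m n : ℕ), 0 < m → ∀ (h : (Fin n → Bool) → Bool),
    ((circuitSizeOver B2 (blockCompose h (majFn (2 * m + 1))) : ℝ) ≤
        circuitSizeOver B2 h + 4.5 * (2 * m + 1) * n) ∧
    (∀ ρ : Substitution (Fin n × Fin (2 * m + 1)), ρ.size = m →
      (circuitSizeOver B2 (blockCompose h (majFn (2 * m + 1))) : ℝ) -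
          circuitSizeOver B2 (ρ.apply (blockCompose h (majFn (2 * m + 1)))) ≤
        4.5 * (2 * m + 1) * m)

/-! ### The no-go readings (proved from the fact) -/

/-- **Lemma 1 as printed (all three inequalities)**, the first being the proved
`circuitSizeOver_le_blockCompose`. [cite: GolovnevHirschKnopKulikov2016, Lemma 1 (PDF p. 6)] -/
theorem GateEliminationLimit.lemma1 (hL : GateEliminationLimit) {m : ℕ} (hm : 0 < m) (n : ℕ)
    (h : (Fin n → Bool) → Bool) :
    circuitSizeOver B2 h ≤ circuitSizeOver B2 (blockCompose h (majFn (2 * m + 1))) ∧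
    ((circuitSizeOver B2 (blockCompose h (majFn (2 * m + 1))) : ℝ) ≤
        circuitSizeOver B2 h + 4.5 * (2 * m + 1) * n) ∧
    (∀ ρ : Substitution (Fin n × Fin (2 * m + 1)), ρ.size = m →
      (circuitSizeOver B2 (blockCompose h (majFn (2 * m + 1))) : ℝ) -
          circuitSizeOver B2 (ρ.apply (blockCompose h (majFn (2 * m + 1)))) ≤
        4.5 * (2 * m + 1) * m) :=
  ⟨circuitSizeOver_le_blockCompose h _ (majFn_const m), (hL m n hm h).1, (hL m n hm h).2⟩

/-- **One-step gain is bounded by a constant depending only on `m`**: for every `h` (however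
complex) and every `m`-substitution `ρ` of `f = h ⋄ MAJ_{2m+1}`,
`gates(f) - gates(f|_ρ) ≤ 4.5(2m+1)m`. [cite: GolovnevHirschKnopKulikov2016, Lemma 1 (PDF p. 6)] -/
theorem GateEliminationLimit.gain_le (hL : GateEliminationLimit) {m n : ℕ} (hm : 0 < m)
    (h : (Fin n → Bool) → Bool) (ρ : Substitution (Fin n × Fin (2 * m + 1))) (hρ : ρ.size = m) :
    (circuitSizeOver B2 (blockCompose h (majFn (2 * m + 1))) : ℝ) -
        circuitSizeOver B2 (ρ.apply (blockCompose h (majFn (2 * m + 1)))) ≤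
      4.5 * (2 * m + 1) * m :=
  (hL m n hm h).2 ρ hρ

/-- **No induction step with a large constant gain**: a gate-elimination step in the sense of
§3.1 for the measure `gates` — "for every `f` in the family there is an `m`-substitution `ρ`
with `gates(f|_ρ) ≤ gates(f) - gain`" — cannot hold with `gain > 4.5(2m+1)m` for any family
containing some `h ⋄ MAJ_{2m+1}`. [cite: GolovnevHirschKnopKulikov2016, §3.1 (PDF p. 5: induction step) and Lemma 1 (PDF p. 6)] -/
theorem GateEliminationLimit.no_step_with_large_gain (hL : GateEliminationLimit) {m n : ℕ}
    (hm : 0 < m) (h : (Fin n → Bool) → Bool) {gain : ℝ} (hgain : 4.5 * (2 * m + 1) * m < gain) :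
    ¬ ∃ ρ : Substitution (Fin n × Fin (2 * m + 1)), ρ.size = m ∧
        (circuitSizeOver B2 (ρ.apply (blockCompose h (majFn (2 * m + 1)))) : ℝ) ≤
          circuitSizeOver B2 (blockCompose h (majFn (2 * m + 1))) - gain := by
  rintro ⟨ρ, hρ, hstep⟩
  have := hL.gain_le hm h ρ hρ
  linarith

/-- **The sandwich**: the resistant function `h ⋄ MAJ_{2m+1}` has complexity between `gates(h)`
(proved) and `gates(h) + 4.5(2m+1)n` (vendored) — so it is as hard as `h` up to a linear
additive term, for `h` of any complexity. [cite: GolovnevHirschKnopKulikov2016, Lemma 1 and Remark (PDF p. 6)] -/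
theorem GateEliminationLimit.complexity_sandwich (hL : GateEliminationLimit) {m n : ℕ}
    (hm : 0 < m) (h : (Fin n → Bool) → Bool) :
    circuitSizeOver B2 h ≤ circuitSizeOver B2 (blockCompose h (majFn (2 * m + 1))) ∧
      (circuitSizeOver B2 (blockCompose h (majFn (2 * m + 1))) : ℝ) ≤
        circuitSizeOver B2 h + 4.5 * (2 * m + 1) * n :=
  ⟨circuitSizeOver_le_blockCompose h _ (majFn_const m), (hL m n hm h).1⟩

end Literature.Barriers.PneNP

end
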